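import Mathlib.Algebra.Central.Basic
import Mathlib.RingTheory.SimpleRing.Basic
import Mathlib.Algebra.Algebra.Bilinear
import Mathlib.LinearAlgebra.FiniteDimensional.Lemmas
import Mathlib.LinearAlgebra.FreeModule.Finite.Matrix
import HarnessLib

/-!
# Central simple algebras: `D ⊗ Dᵒᵖ → End_K(D)` is bijective (the Azumaya property)

For a central simple algebra `D` over a field `K` we prove the classical lemma behind the
isomorphism `D ⊗_K Dᵒᵖ ≅ End_K(D)` (Azumaya–Nakayama; Bourbaki, *Algèbre* VIII §10;
Farb–Dennis, *Noncommutative Algebra*, Thm. 3.1 "the sandwich map"; Gille–Szamuely,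
*Central Simple Algebras and Galois Cohomology*, Lemma 2.4.4 area):

* `eq_zero_of_forall_sum_mul_mul_eq_zero` — if `b₁, …, b_m ∈ D` are `K`-linearly independent and
  `∑ᵢ aᵢ x bᵢ = 0` for all `x ∈ D`, then all `aᵢ = 0` (induction on `m`: normalise `a₁ = 1`
  through the two-sided ideal generated by `a₁ ≠ 0`, which is `D` by simplicity, then commutators
  `[y, aᵢ]` give a shorter relation, so the `aᵢ` are central, i.e. scalars, contradicting the
  independence of the `bᵢ`);
* `bijective_sum_mulLeft_comp_mulRight` — for a `K`-basis `(βᵢ)` of a finite-dimensional central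
  simple `D`, the `K`-linear map `(aᵢ)ᵢ ↦ (x ↦ ∑ᵢ aᵢ x βᵢ)` from `D^ι` to `End_K(D)` is bijective
  (injective by the lemma, surjective by the dimension count `dim D · dim D = dim End_K(D)`),
  i.e. every `K`-linear endomorphism of `D` is uniquely of the form `x ↦ ∑ᵢ aᵢ x βᵢ`.

Mathlib has the definition `IsAzumaya` and `AlgHom.mulLeftRight` but (at the pinned revision) not
the fact that central simple algebras over a field are Azumaya; the elementwise form above is what
`Literature.NumberTheory.Automorphic.QuaternionAlgebraAdelicModuleProofs` uses.

## References

* B. Farb, R. K. Dennis, *Noncommutative Algebra*, GTM 144 (1993), Ch. 3, Thm. 3.1 and Cor. 3.5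
  (`A ⊗ Aᵒᵖ ≅ End_k(A)` for central simple `A`).
* N. Bourbaki, *Algèbre*, Ch. VIII (2012), §10.
-/

namespace Literature.RingTheory.CentralSimple

open scoped BigOperators

variable {K : Type*} [Field K] {D : Type*} [Ring D] [Algebra K D]

/-- **Dedekind–Artin type independence lemma for central simple algebras.** Let `D` be a central
simple algebra over the field `K`, `b : Fin m → D` a `K`-linearly independent family and
`a : Fin m → D` with `∑ᵢ aᵢ x bᵢ = 0` for every `x ∈ D`. Then `a = 0`. (Induction on `m`. If some
`a_k = 0`, drop the index `k`. Otherwise the first coordinates of all families `c` with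
`∑ᵢ cᵢ x bᵢ ≡ 0` form a non-zero two-sided ideal, which is `D`; pick such a `c` with `c₀ = 1`;
for every `y` the family `y cᵢ - cᵢ y` again satisfies the relation and vanishes at `i = 0`, so
by induction all `cᵢ` are central, hence scalars `cᵢ = λᵢ · 1` with `λ₀ = 1`, and `x = 1` gives
`∑ λᵢ bᵢ = 0`, contradicting independence.) This is the key step of the classical proof that
`D ⊗_K Dᵒᵖ → End_K(D)` is injective (Farb–Dennis, *Noncommutative Algebra*, proof of Thm. 3.1).
[folklore] -/
theorem eq_zero_of_forall_sum_mul_mul_eq_zero [Algebra.IsCentral K D] [IsSimpleRing D] :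
    ∀ (m : ℕ) (a b : Fin m → D), LinearIndependent K b →
      (∀ x : D, ∑ i, a i * x * b i = 0) → ∀ i, a i = 0 := by
  intro m
  induction m with
  | zero => intro a b _ _ i; exact Fin.elim0 i
  | succ m ih =>
    intro a b hb h
    -- reduction: a family vanishing at some index `k` vanishes identically
    have drop : ∀ (c : Fin (m + 1) → D), (∀ x : D, ∑ i, c i * x * b i = 0) →
        ∀ k, c k = 0 → ∀ i, c i = 0 := by
      intro c hc k hk i
      have hb' : LinearIndependent K (b ∘ k.succAbove) :=
        hb.comp _ Fin.succAbove_right_injective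
      have hc' : ∀ x : D, ∑ j, (c ∘ k.succAbove) j * x * (b ∘ k.succAbove) j = 0 := fun x => by
        have := hc x
        rw [Fin.sum_univ_succAbove _ k, hk, zero_mul, zero_mul, zero_add] at this
        exact this
      have hzero := ih (c ∘ k.succAbove) (b ∘ k.succAbove) hb' hc'
      by_cases hik : i = k
      · rw [hik, hk]
      · obtain ⟨j, rfl⟩ := Fin.exists_succAbove_eq hik
        exact hzero j
    by_contra hne
    push Not at hne
    obtain ⟨i₀, hi₀⟩ := hne
    -- all `a i ≠ 0`
    have hall : ∀ i, a i ≠ 0 := fun i hi => hi₀ (drop a h i hi i₀)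
    -- the two-sided ideal of first coordinates of relation families
    let V : Set (Fin (m + 1) → D) := {c | ∀ x : D, ∑ i, c i * x * b i = 0}
    have hV_add : ∀ c ∈ V, ∀ c' ∈ V, c + c' ∈ V := fun c hc c' hc' x => by
      simp only [Pi.add_apply, add_mul, Finset.sum_add_distrib, hc x, hc' x, add_zero]
    have hV_left : ∀ c ∈ V, ∀ u : D, (fun i => u * c i) ∈ V := fun c hc u x => by
      have : ∑ i, u * c i * x * b i = u * ∑ i, c i * x * b i := by
        rw [Finset.mul_sum]
        exact Finset.sum_congr rfl fun i _ => by simp only [mul_assoc]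
      show ∑ i, u * c i * x * b i = 0
      rw [this, hc x, mul_zero]
    have hV_right : ∀ c ∈ V, ∀ v : D, (fun i => c i * v) ∈ V := fun c hc v x => by
      show ∑ i, c i * v * x * b i = 0
      have := hc (v * x)
      simpa only [mul_assoc] using this
    let I : TwoSidedIdeal D := TwoSidedIdeal.mk' {y | ∃ c ∈ V, c 0 = y}
      ⟨0, fun x => by simp, rfl⟩
      (by rintro _ _ ⟨c, hc, rfl⟩ ⟨c', hc', rfl⟩; exact ⟨c + c', hV_add c hc c' hc', rfl⟩)
      (by rintro _ ⟨c, hc, rfl⟩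
          exact ⟨-c, fun x => by simp only [Pi.neg_apply, neg_mul, Finset.sum_neg_distrib, hc x,
            neg_zero], rfl⟩)
      (by rintro u _ ⟨c, hc, rfl⟩; exact ⟨fun i => u * c i, hV_left c hc u, rfl⟩)
      (by rintro _ v ⟨c, hc, rfl⟩; exact ⟨fun i => c i * v, hV_right c hc v, rfl⟩)
    have hmemI : ∀ y, y ∈ I ↔ ∃ c ∈ V, c 0 = y := fun y => TwoSidedIdeal.mem_mk' _ _ _ _ _ _ y
    -- `a 0 ∈ I` is non-zero, so `1 ∈ I`
    have h1 : (1 : D) ∈ I :=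
      IsSimpleRing.one_mem_of_ne_zero_mem I (hall 0) ((hmemI _).2 ⟨a, h, rfl⟩)
    obtain ⟨c, hc, hc0⟩ := (hmemI 1).1 h1
    -- all `c i` are central
    have hcentral : ∀ i, c i ∈ Subalgebra.center K D := by
      intro i
      rw [Subalgebra.mem_center_iff]
      intro y
      have hfam : (fun i => y * c i - c i * y) ∈ V := by
        have h₁ := hV_left c hc y
        have h₂ := hV_right c hc y
        intro x
        have e : ∑ i, (y * c i - c i * y) * x * b i =
            ∑ i, y * c i * x * b i - ∑ i, c i * y * x * b i := by
          rw [← Finset.sum_sub_distrib]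
          exact Finset.sum_congr rfl fun i _ => by rw [sub_mul, sub_mul]
        rw [e, h₁ x, h₂ x, sub_zero]
      have := drop _ hfam 0 (by simp only [hc0, mul_one, one_mul, sub_self]) i
      exact sub_eq_zero.1 this
    -- hence scalars, with `c 0 = 1`
    choose e he using fun i => (Algebra.IsCentral.mem_center_iff K).1 (hcentral i)
    have hsum : ∑ i, e i • b i = 0 := by
      have := hc 1
      simp only [mul_one] at this
      rw [← this]
      exact Finset.sum_congr rfl fun i _ => by rw [he i, Algebra.smul_def]
    have he0 : e 0 = 0 := Fintype.linearIndependent_iff.1 hb e hsum 0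
    have : c 0 = 0 := by rw [he 0, he0, map_zero]
    exact one_ne_zero (hc0.symm.trans this)

/-- **Every `K`-linear endomorphism of a central simple algebra is uniquely a sandwich
`x ↦ ∑ᵢ aᵢ x βᵢ`.** For a finite-dimensional central simple algebra `D` over a field `K` with
`K`-basis `β : Fin m → D`, the `K`-linear map `D^m → End_K(D)`, `a ↦ ∑ᵢ L_{aᵢ} ∘ R_{βᵢ}`
(`L`, `R` left and right multiplications) is bijective: injective by
`eq_zero_of_forall_sum_mul_mul_eq_zero`, surjective by counting dimensions
(`m · dim D = dim D · dim D = dim End_K(D)`). Equivalently `D ⊗_K Dᵒᵖ ≅ End_K(D)`, i.e. `D` is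
an Azumaya `K`-algebra (Farb–Dennis, *Noncommutative Algebra*, Thm. 3.1 / Cor. 3.5; Bourbaki,
*Algèbre* VIII §10). [folklore] -/
theorem bijective_sum_mulLeft_comp_mulRight [Algebra.IsCentral K D] [IsSimpleRing D]
    [FiniteDimensional K D] {m : ℕ} (β : Module.Basis (Fin m) K D) :
    Function.Bijective fun a : Fin m → D =>
      ∑ i, LinearMap.mulLeft K (a i) ∘ₗ LinearMap.mulRight K (β i) := by
  -- the map is `K`-linear
  let Ψ : (Fin m → D) →ₗ[K] Module.End K D :=
    { toFun := fun a => ∑ i, LinearMap.mulLeft K (a i) ∘ₗ LinearMap.mulRight K (β i)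
      map_add' := fun a a' => by
        ext x
        simp only [Pi.add_apply, LinearMap.coe_sum, Finset.sum_apply, LinearMap.comp_apply,
          LinearMap.mulRight_apply, LinearMap.mulLeft_apply, add_mul, Finset.sum_add_distrib,
          LinearMap.add_apply]
      map_smul' := fun c a => by
        ext x
        simp only [Pi.smul_apply, LinearMap.coe_sum, Finset.sum_apply, LinearMap.comp_apply,
          LinearMap.mulRight_apply, LinearMap.mulLeft_apply, smul_mul_assoc, RingHom.id_apply,
          LinearMap.smul_apply, Finset.smul_sum] }
  have hΨ : ∀ a x, Ψ a x = ∑ i, a i * x * β i := fun a x => by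
    simp only [Ψ, LinearMap.coe_mk, AddHom.coe_mk, LinearMap.coe_sum, Finset.sum_apply,
      LinearMap.comp_apply, LinearMap.mulRight_apply, LinearMap.mulLeft_apply, mul_assoc]
  have hinj : Function.Injective Ψ := by
    refine (injective_iff_map_eq_zero Ψ).2 fun a ha => funext fun i => ?_
    refine eq_zero_of_forall_sum_mul_mul_eq_zero m a β β.linearIndependent (fun x => ?_) i
    rw [← hΨ, ha, LinearMap.zero_apply]
  have hdim : Module.finrank K (Fin m → D) = Module.finrank K (Module.End K D) := by
    rw [Module.finrank_pi_fintype, Finset.sum_const, Finset.card_univ, Fintype.card_fin,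
      smul_eq_mul, Module.finrank_linearMap, Module.finrank_eq_card_basis β, Fintype.card_fin]
  exact ⟨hinj, (LinearMap.injective_iff_surjective_of_finrank_eq_finrank hdim).1 hinj⟩

end Literature.RingTheory.CentralSimple
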